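import Literature.NumberTheory.CubicFields.ThreeTorsionParametrizationIdeal
import HarnessLib

/-!
# The `ℤ[τ]`-module structure of `ℤθ₁ + ℤθ₂` and the norms of `θ₁, θ₂` (Bhargava, HCL I, (20) and (24); Bhargava–Varma (7))

Topic `Literature/NumberTheory/CubicFields`, continuing `ThreeTorsionParametrizationIdeal.lean`.
Fifth step of the class-field-theory-free road to the Davenport–Heilbronn theorem on `Cl(K)[3]`
(Bhargava–Varma 2016, §§2–3).

Bhargava–Varma, §2.1 (after Thm 9): "The `𝒪`-ideal structure of the rank 2 `ℤ`-module `I` is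
given by the following action of `τ` on the basis elements of `I`:
`τ · α = ((B + ε)/2) · α + A · β` and `τ · β = −C · α + ((ε − B)/2) · β`, where
`A = b² − ac, B = ad − bc, C = c² − bd`" (HCL I (20) with (24)); and §2.3: "`Q(x,y) = Ax² + Bxy + Cy²`
… also describes the norm form on `I` mapping into `ℤ`". For the representative `α = θ₁, β = θ₂`
(`θᵢ = (gᵢ + aᵢ s)/2`, `s² = D = disc C`, `τ = (ε + s)/2`) this file proves:

* `two_dvd_hess_B_sub` — `B ≡ ε (mod 2)` (so the displayed coefficients are integers);
* `tau_mul_theta₁`, `tau_mul_theta₂` — **the displayed action of `τ`** (identities in `K`);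
* `theta₁_mul_conj`, `theta₂_mul_conj`, `delta_mul_conj` — **norms**: with the conjugates
  `θ̄ᵢ = θᵢ − aᵢ s = (gᵢ − aᵢ s)/2`, `θ₁θ̄₁ = A²C`, `θ₂θ̄₂ = AC²`, hence
  `N(δ) = δδ̄ = A³C³ = (AC)³` for `δ = θ₁θ₂`, while `θ₁θ̄₂ − θ̄₁θ₂ = −AC · s` (`theta₁_mul_conj₂_sub`:
  the oriented index of `ℤθ₁ + ℤθ₂` in `ℤ + ℤτ` is `AC`, so `N(δ) = (oriented index)³`: the
  norm condition `N(I)³ = N(δ)` of HCL I Thm 13 holds for the basis `(θ₁, θ₂)` exactly when it is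
  positively oriented, `AC > 0` — automatic for `D < 0`);
* `mem_cubicIdeal_iff` — **`I = (θ₁, θ₂) = ℤθ₁ + ℤθ₂` as a set**, whenever `𝓞 K = ℤ + ℤτ`
  (hypothesis `hO`; true for `K` the quadratic field of discriminant `D`): the `ℤ`-span is already
  an ideal, by the displayed action.

All statements are proved.

## References

* M. Bhargava, *Higher composition laws I*, Ann. of Math. 159 (2004), §3.3 (20), §3.4 (24)
  [Bhargava2004HCL1].
* M. Bhargava, I. Varma, *The mean number of 3-torsion elements in the class groups and ideal
  groups of quadratic orders*, Proc. LMS 112 (2016) = arXiv:1401.5875, §2.1 (7), §2.3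
  [BhargavaVarma2016].
-/

namespace Literature.NumberTheory.CubicFields

open NumberField
open scoped NumberField

namespace SymCubic

variable {K : Type*} [Field K] [CharZero K]

/-! ### Parity of `B` -/

/-- `B ≡ ε (mod 2)`: `B² − 4AC = disc C ≡ ε (mod 4)` and `ε ∈ {0, 1}`. [folklore] -/
theorem two_dvd_hess_B_sub (C : SymCubic ℤ) {ε : ℤ} (hε : ε = 0 ∨ ε = 1) (h4 : (4 : ℤ) ∣ C.disc - ε) :
    (2 : ℤ) ∣ C.hess.2.1 - ε := by
  have hd := discr_hess C
  obtain ⟨m, hm⟩ := h4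
  obtain ⟨k, hk | hk⟩ := Int.even_or_odd' C.hess.2.1
  · -- `B = 2k`: then `4 ∣ disc C`, so `ε = 0`
    have hB2 : C.hess.2.1 ^ 2 = 4 * k ^ 2 := by rw [hk]; ring
    rcases hε with rfl | rfl
    · exact ⟨k, by omega⟩
    · exfalso
      have h41 : (4 : ℤ) ∣ 1 := ⟨k ^ 2 - C.hess.1 * C.hess.2.2 - m, by linarith⟩
      omega
  · have hB2 : C.hess.2.1 ^ 2 = 4 * (k ^ 2 + k) + 1 := by rw [hk]; ring
    rcases hε with rfl | rfl
    · exfalso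
      have h41 : (4 : ℤ) ∣ 1 := ⟨-(k ^ 2 + k - C.hess.1 * C.hess.2.2 - m), by linarith⟩
      omega
    · exact ⟨k, by omega⟩

/-! ### The action of `τ = (ε + s)/2` on `θ₁, θ₂` -/

section Action

variable (C : SymCubic ℤ) {s : K} (hs : s ^ 2 = (C.disc : K)) (ε : K)
include hs

/-- **`τ · θ₁ = ((B + ε)/2) θ₁ + A θ₂`** (Bhargava–Varma §2.1; HCL I (20) with (24)), for
`τ = (ε + s)/2` and any `ε`. [cite: BhargavaVarma2016, §2.1 (the action of τ on the basis of I)] -/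
theorem tau_mul_theta₁ :
    ((ε + s) / 2) * (C.thetaForm s).a₁
      = (((C.hess.2.1 : K) + ε) / 2) * (C.thetaForm s).a₁ + (C.hess.1 : K) * (C.thetaForm s).a₂ := by
  simp only [thetaForm_a₁, thetaForm_a₂, hess, gCov]
  push_cast
  have hD : s ^ 2 = ((C.a₀ ^ 2 * C.a₃ ^ 2 - 3 * C.a₁ ^ 2 * C.a₂ ^ 2 - 6 * C.a₀ * C.a₁ * C.a₂ * C.a₃
      + 4 * C.a₀ * C.a₂ ^ 3 + 4 * C.a₁ ^ 3 * C.a₃ : ℤ) : K) := by rw [hs]; rfl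
  push_cast at hD
  linear_combination ((C.a₁ : K) / 4) * hD

/-- **`τ · θ₂ = −C θ₁ + ((ε − B)/2) θ₂`** (Bhargava–Varma §2.1; HCL I (20) with (24)).
[cite: BhargavaVarma2016, §2.1 (the action of τ on the basis of I)] -/
theorem tau_mul_theta₂ :
    ((ε + s) / 2) * (C.thetaForm s).a₂
      = -(C.hess.2.2 : K) * (C.thetaForm s).a₁ + ((ε - (C.hess.2.1 : K)) / 2) * (C.thetaForm s).a₂ := by
  simp only [thetaForm_a₁, thetaForm_a₂, hess, gCov]
  push_cast
  have hD : s ^ 2 = ((C.a₀ ^ 2 * C.a₃ ^ 2 - 3 * C.a₁ ^ 2 * C.a₂ ^ 2 - 6 * C.a₀ * C.a₁ * C.a₂ * C.a₃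
      + 4 * C.a₀ * C.a₂ ^ 3 + 4 * C.a₁ ^ 3 * C.a₃ : ℤ) : K) := by rw [hs]; rfl
  push_cast at hD
  linear_combination ((C.a₂ : K) / 4) * hD

end Action

/-! ### Norms -/

section Norms

variable (C : SymCubic ℤ) {s : K} (hs : s ^ 2 = (C.disc : K))
include hs

omit [CharZero K] in
/-- `s² = disc C`, expanded. [folklore] -/
private theorem hD_cast : s ^ 2 = (C.a₀ : K) ^ 2 * (C.a₃ : K) ^ 2 - 3 * (C.a₁ : K) ^ 2 * (C.a₂ : K) ^ 2
    - 6 * (C.a₀ : K) * (C.a₁ : K) * (C.a₂ : K) * (C.a₃ : K) + 4 * (C.a₀ : K) * (C.a₂ : K) ^ 3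
    + 4 * (C.a₁ : K) ^ 3 * (C.a₃ : K) := by
  rw [hs, disc]; push_cast; ring

/-- **`N(θ₁) = θ₁θ̄₁ = A²C`** with `θ̄₁ = θ₁ − a₁s = (g₁ − a₁s)/2`. [folklore] -/
theorem theta₁_mul_conj :
    (C.thetaForm s).a₁ * ((C.thetaForm s).a₁ - (C.a₁ : K) * s)
      = (C.hess.1 : K) ^ 2 * (C.hess.2.2 : K) := by
  have hD := hD_cast C hs
  simp only [thetaForm_a₁, hess, gCov]
  push_cast
  linear_combination (-((C.a₁ : K) ^ 2) / 4) * hD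

/-- **`N(θ₂) = θ₂θ̄₂ = AC²`**. [folklore] -/
theorem theta₂_mul_conj :
    (C.thetaForm s).a₂ * ((C.thetaForm s).a₂ - (C.a₂ : K) * s)
      = (C.hess.1 : K) * (C.hess.2.2 : K) ^ 2 := by
  have hD := hD_cast C hs
  simp only [thetaForm_a₂, hess, gCov]
  push_cast
  linear_combination (-((C.a₂ : K) ^ 2) / 4) * hD

/-- **`N(δ) = (AC)³`** for `δ = θ₁θ₂`: `δδ̄ = A³C³`. [folklore] -/
theorem delta_mul_conj :
    ((C.thetaForm s).a₁ * (C.thetaForm s).a₂)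
        * (((C.thetaForm s).a₁ - (C.a₁ : K) * s) * ((C.thetaForm s).a₂ - (C.a₂ : K) * s))
      = ((C.hess.1 : K) * (C.hess.2.2 : K)) ^ 3 := by
  have h1 := theta₁_mul_conj C hs
  have h2 := theta₂_mul_conj C hs
  linear_combination ((C.thetaForm s).a₂ * ((C.thetaForm s).a₂ - (C.a₂ : K) * s)) * h1
    + ((C.hess.1 : K) ^ 2 * (C.hess.2.2 : K)) * h2

omit hs in
/-- **The oriented index of `ℤθ₁ + ℤθ₂`**: `θ₁θ̄₂ − θ̄₁θ₂ = −AC · s` (the determinant of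
`(θ₁, θ₂)` on the basis `(1, τ)` is `c₁a₂ − c₂a₁ = AC`); with `N(δ) = (AC)³` this is the norm
condition "`N(I)³ = N(δ)`" of HCL I Thm 13, up to the sign `sign(AC)` recording whether the basis
`(θ₁, θ₂)` is positively oriented. [folklore] -/
theorem theta₁_mul_conj₂_sub :
    (C.thetaForm s).a₁ * ((C.thetaForm s).a₂ - (C.a₂ : K) * s)
        - ((C.thetaForm s).a₁ - (C.a₁ : K) * s) * (C.thetaForm s).a₂
      = -((C.hess.1 : K) * (C.hess.2.2 : K)) * s := by
  have h := a₁_mul_theta₂_sub C s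
  linear_combination s * h

end Norms

/-! ### `I = ℤθ₁ + ℤθ₂` as a set -/

section Span

variable (C : SymCubic ℤ) {s : K} {ε : ℤ} (hs : s ^ 2 = (C.disc : K)) (hε : ε = 0 ∨ ε = 1)
  (h4 : (4 : ℤ) ∣ C.disc - ε)
include hs hε h4

/-- **`(θ₁, θ₂) = ℤθ₁ + ℤθ₂`**: if `𝓞 K = ℤ + ℤτ` (`τ = (ε + s)/2`; hypothesis `hO`), the ideal
`I(C)` generated by `θ₁, θ₂` consists exactly of the `ℤ`-combinations `mθ₁ + nθ₂` — the `ℤ`-module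
`ℤθ₁ + ℤθ₂` is stable under `τ` by the displayed action (BV §2.1: "This completely (and
explicitly) determines the triple `(𝒪, I, δ)`"; HCL I: "`I`, currently given as a `ℤ`-module, is
actually an ideal of `S`"). Stated with integral representatives `t₁, t₂`. [cite: Bhargava2004HCL1, §3.4 (proof of Theorem 13: I is an ideal of S, via (20) and (24))] -/
theorem mem_cubicIdeal_iff (hO : ∀ x : 𝓞 K, ∃ m n : ℤ, (x : K) = m + n * (((ε : K) + s) / 2))
    {t₁ t₂ : 𝓞 K} (ht₁ : (t₁ : K) = (C.thetaForm s).a₁) (ht₂ : (t₂ : K) = (C.thetaForm s).a₂)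
    (x : 𝓞 K) :
    x ∈ C.cubicIdeal s ↔ ∃ m n : ℤ, x = (m : 𝓞 K) * t₁ + (n : 𝓞 K) * t₂ := by
  rw [cubicIdeal_eq_span C ht₁ ht₂]
  constructor
  · intro hx
    -- integrality of `τ` and of the coefficients `(B ± ε)/2`
    obtain ⟨τ', hτ'⟩ : ∃ τ' : 𝓞 K, (τ' : K) = ((ε : K) + s) / 2 :=
      ⟨⟨_, (mem_integralClosure_iff ℤ K).mpr (isIntegral_tau hs hε h4)⟩, rfl⟩
    obtain ⟨k, hk⟩ := two_dvd_hess_B_sub C hε h4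
    have hBp : (((C.hess.2.1 : K)) + ε) / 2 = ((k + ε : ℤ) : K) := by
      have : (C.hess.2.1 : K) = 2 * k + ε := by
        have : C.hess.2.1 = 2 * k + ε := by linarith
        exact_mod_cast this
      rw [this]; push_cast; ring
    have hBm : ((ε : K) - (C.hess.2.1 : K)) / 2 = ((-k : ℤ) : K) := by
      have : (C.hess.2.1 : K) = 2 * k + ε := by
        have : C.hess.2.1 = 2 * k + ε := by linarith
        exact_mod_cast this
      rw [this]; push_cast; ring
    -- `τ t₁`, `τ t₂` in `ℤ t₁ + ℤ t₂`
    have hτ1 : τ' * t₁ = ((k + ε : ℤ) : 𝓞 K) * t₁ + ((C.hess.1 : ℤ) : 𝓞 K) * t₂ := by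
      apply RingOfIntegers.coe_injective
      simp only [map_mul, map_add, map_intCast]
      rw [← RingOfIntegers.coe_eq_algebraMap τ', ← RingOfIntegers.coe_eq_algebraMap t₁,
        ← RingOfIntegers.coe_eq_algebraMap t₂, hτ', ht₁, ht₂, ← hBp]
      exact tau_mul_theta₁ C hs ε
    have hτ2 : τ' * t₂ = ((-C.hess.2.2 : ℤ) : 𝓞 K) * t₁ + ((-k : ℤ) : 𝓞 K) * t₂ := by
      apply RingOfIntegers.coe_injective
      simp only [map_mul, map_add, map_intCast]
      rw [← RingOfIntegers.coe_eq_algebraMap τ', ← RingOfIntegers.coe_eq_algebraMap t₁,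
        ← RingOfIntegers.coe_eq_algebraMap t₂, hτ', ht₁, ht₂, ← hBm]
      push_cast
      exact tau_mul_theta₂ C hs ε
    refine Submodule.span_induction (p := fun x _ => ∃ m n : ℤ, x = (m : 𝓞 K) * t₁ + (n : 𝓞 K) * t₂)
      ?_ ?_ ?_ ?_ hx
    · intro y hy
      simp only [Set.mem_insert_iff, Set.mem_singleton_iff] at hy
      rcases hy with h | h <;> rw [h]
      · exact ⟨1, 0, by simp⟩
      · exact ⟨0, 1, by simp⟩
    · exact ⟨0, 0, by simp⟩
    · rintro y z - - ⟨m, n, rfl⟩ ⟨m', n', rfl⟩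
      exact ⟨m + m', n + n', by push_cast; ring⟩
    · rintro r y - ⟨m, n, rfl⟩
      obtain ⟨u, v, huv⟩ := hO r
      have hr : r = (u : 𝓞 K) + (v : 𝓞 K) * τ' := by
        apply RingOfIntegers.coe_injective
        simp only [map_mul, map_add, map_intCast]
        rw [← RingOfIntegers.coe_eq_algebraMap τ', ← RingOfIntegers.coe_eq_algebraMap r, hτ']
        exact huv
      refine ⟨u * m + v * (m * (k + ε) + n * (-C.hess.2.2)), u * n + v * (m * C.hess.1 + n * (-k)), ?_⟩
      rw [smul_eq_mul, hr]
      have e1 : (v : 𝓞 K) * τ' * ((m : 𝓞 K) * t₁) = (v * m : 𝓞 K) * (τ' * t₁) := by ring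
      have e2 : (v : 𝓞 K) * τ' * ((n : 𝓞 K) * t₂) = (v * n : 𝓞 K) * (τ' * t₂) := by ring
      calc ((u : 𝓞 K) + (v : 𝓞 K) * τ') * ((m : 𝓞 K) * t₁ + (n : 𝓞 K) * t₂)
          = (u : 𝓞 K) * ((m : 𝓞 K) * t₁ + (n : 𝓞 K) * t₂)
              + (v * m : 𝓞 K) * (τ' * t₁) + (v * n : 𝓞 K) * (τ' * t₂) := by ring
        _ = _ := by rw [hτ1, hτ2]; push_cast; ring
  · rintro ⟨m, n, rfl⟩
    exact Ideal.add_mem _ (Ideal.mul_mem_left _ _ (Ideal.subset_span (by simp)))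
      (Ideal.mul_mem_left _ _ (Ideal.subset_span (by simp)))

end Span

end SymCubic

end Literature.NumberTheory.CubicFields
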